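import Summits.Ventures.Crystal3D.Theorems.StickyWulffConstantNoReconstructionGainCellFluxGlue
import Summits.Ventures.Crystal3D.Theorems.StickyWulffConstantNoReconstructionGainBlanketGlue
import Mathlib.Analysis.InnerProductSpace.Projection.Reflection
import Mathlib.MeasureTheory.Measure.Haar.InnerProductSpace
import HarnessLib

/-!
# CELLFLUX — the isolated-body instance `LocalFluxBoundAt a κ 0`, sharp

HONEST FRAMING. Part of the venture `Summits/Ventures/Crystal3D` (cell `crystal3d-full`), helper
`--supports` the crux `NoReconstructionGain` (stmt-Ventures-19144, route
`route-Ventures-StickyWulffConstant`), CELLFLUX architecture γ of planner cf-p1 (gen 15; definitions landed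
verbatim as `Theorems/…CellFluxDefs.lean`).  The `d = 0` instance `LocalFluxBoundAt a κ 0` is a hypothesis of
the glue targets `BlanketOfPoolFlux` / `BlanketOfStarFlux` / `BlanketOfRimPool`; the planner's docstring says
"`d = 0` is an identity (trivially true)" at `a = fluxRadius`.  We prove the sharp statement

  `0 ≤ a → (LocalFluxBoundAt a κ 0 ↔ a ≤ fluxRadius)`   (every `κ`),

i.e. BY NAME `localFluxBoundAt_zero : ∀ a κ, 0 ≤ a → a ≤ fluxRadius → LocalFluxBoundAt a κ 0` together with the
converse `not_localFluxBoundAt_zero_of_lt` (an isolated ball is a counterexample for `a > fluxRadius`).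

The one geometric input is the volume of the unit-height slab of the cylinder of radius `a` about an axis of
ARBITRARY unit direction `ν` through an arbitrary centre `c` (`volume_lateralSlab`: `π a²`), obtained from the
`e₃` case (`volume_cylinder_fin_three`, file `…BlanketGlue`) by a translation and the reflection isometry
`ν ↦ e₃` (`Submodule.reflection_sub`).  This is the "cylinder volume at a general `ν`" that the `±e₃`-only
glue files left open; it is stated for reuse.

WHAT THIS IS NOT: any instance `d ≥ 1` of the local lemma; not the blanket bound; rung F-C1 not moved.
-/

noncomputable section

namespace Summit.Ventures.Crystal3D.Theorems

open Summit.Ventures.Crystal3D Finset MeasureTheory Set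
open Summit.Ventures.Crystal3D.Cruxes.NoReconstructionGain.CellFlux
open scoped InnerProductSpace

/-! ### An isometry taking `ν` to `e₃` -/

/-- For every unit vector `ν` of `ℝ³` there is a linear isometry of `ℝ³` onto itself taking `ν` to `e₃`
(the reflection in the bisector hyperplane of `ν` and `e₃`). -/
theorem exists_linearIsometryEquiv_apply_eq_single_two (ν : EuclideanSpace ℝ (Fin 3)) (hν : ‖ν‖ = 1) :
    ∃ g : EuclideanSpace ℝ (Fin 3) ≃ₗᵢ[ℝ] EuclideanSpace ℝ (Fin 3),
      g ν = EuclideanSpace.single (2 : Fin 3) (1 : ℝ) :=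
  ⟨Submodule.reflection (ℝ ∙ (ν - EuclideanSpace.single (2 : Fin 3) (1 : ℝ)))ᗮ,
    Submodule.reflection_sub (by rw [hν, norm_e3])⟩

/-! ### The slab of the cylinder of radius `a` about an arbitrary axis -/

/-- The LATERAL SLAB `{y : lateralSq ν c y ≤ a², |⟪y, ν⟫| ≤ 1/2}` (unit-height slab of the solid cylinder of
radius `a` about the axis through `c` in direction `ν`) is a translate of the one about the axis through the
origin: translating by the lateral part of `c` does not change `⟪·, ν⟫`. -/
theorem lateralSlab_eq_preimage (ν : EuclideanSpace ℝ (Fin 3)) (hν : ‖ν‖ = 1) (c : EuclideanSpace ℝ (Fin 3))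
    (a : ℝ) :
    {y : EuclideanSpace ℝ (Fin 3) | lateralSq ν c y ≤ a ^ 2 ∧ |⟪y, ν⟫_ℝ| ≤ 1 / 2} =
      (fun y => y + (-(c - ⟪c, ν⟫_ℝ • ν))) ⁻¹'
        {z : EuclideanSpace ℝ (Fin 3) | ‖z‖ ^ 2 - ⟪z, ν⟫_ℝ ^ 2 ≤ a ^ 2 ∧ |⟪z, ν⟫_ℝ| ≤ 1 / 2} := by
  ext y
  simp only [Set.mem_setOf_eq, Set.mem_preimage]
  have hνν : ⟪ν, ν⟫_ℝ = 1 := by rw [real_inner_self_eq_norm_sq, hν, one_pow]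
  have h1 : y + -(c - ⟪c, ν⟫_ℝ • ν) = (y + ⟪c, ν⟫_ℝ • ν) - c := by abel
  have h2 : ‖y + -(c - ⟪c, ν⟫_ℝ • ν)‖ ^ 2 - ⟪y + -(c - ⟪c, ν⟫_ℝ • ν), ν⟫_ℝ ^ 2 = lateralSq ν c y := by
    rw [h1]
    have := lateralSq_add_smul ν c y hν ⟪c, ν⟫_ℝ
    unfold lateralSq at this ⊢
    exact this
  have h3 : ⟪y + -(c - ⟪c, ν⟫_ℝ • ν), ν⟫_ℝ = ⟪y, ν⟫_ℝ := by
    rw [inner_add_left, inner_neg_left, inner_sub_left, inner_smul_left, hνν]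
    simp
  rw [h2, h3]

/-- The lateral slab about the origin in direction `ν` is the preimage, under any linear isometry `g` with
`g ν = e₃`, of the lateral slab about the `e₃`-axis written in coordinates. -/
theorem lateralSlab_origin_eq_preimage (ν : EuclideanSpace ℝ (Fin 3))
    (g : EuclideanSpace ℝ (Fin 3) ≃ₗᵢ[ℝ] EuclideanSpace ℝ (Fin 3))
    (hg : g ν = EuclideanSpace.single (2 : Fin 3) (1 : ℝ)) (a : ℝ) :
    {z : EuclideanSpace ℝ (Fin 3) | ‖z‖ ^ 2 - ⟪z, ν⟫_ℝ ^ 2 ≤ a ^ 2 ∧ |⟪z, ν⟫_ℝ| ≤ 1 / 2} =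
      g ⁻¹' {y : EuclideanSpace ℝ (Fin 3) | y 0 ^ 2 + y 1 ^ 2 ≤ a ^ 2 ∧ |y 2| ≤ 1 / 2} := by
  ext z
  simp only [Set.mem_setOf_eq, Set.mem_preimage]
  have hin : ⟪z, ν⟫_ℝ = (g z) 2 := by
    rw [← g.inner_map_map z ν, hg]
    simp [EuclideanSpace.inner_single_right]
  have hnorm : ‖z‖ ^ 2 = (g z) 0 ^ 2 + (g z) 1 ^ 2 + (g z) 2 ^ 2 := by
    rw [← g.norm_map z, EuclideanSpace.real_norm_sq_eq, Fin.sum_univ_three]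
  rw [hin, hnorm]
  constructor
  · rintro ⟨h1, h2⟩; exact ⟨by linarith, h2⟩
  · rintro ⟨h1, h2⟩; exact ⟨by linarith, h2⟩

/-- The coordinate lateral slab about the `e₃`-axis is measurable. -/
theorem measurableSet_cylinder_fin_three (a : ℝ) :
    MeasurableSet {y : EuclideanSpace ℝ (Fin 3) | y 0 ^ 2 + y 1 ^ 2 ≤ a ^ 2 ∧ |y 2| ≤ 1 / 2} := by
  have hc : ∀ i : Fin 3, Continuous fun y : EuclideanSpace ℝ (Fin 3) => y i :=
    fun i => (EuclideanSpace.proj i).continuous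
  have h1 : Measurable fun y : EuclideanSpace ℝ (Fin 3) => y 0 ^ 2 + y 1 ^ 2 :=
    (((hc 0).pow 2).add ((hc 1).pow 2)).measurable
  have h2 : Measurable fun y : EuclideanSpace ℝ (Fin 3) => |y 2| :=
    (continuous_abs.comp (hc 2)).measurable
  exact (measurableSet_le h1 measurable_const).inter (measurableSet_le h2 measurable_const)

/-- **Volume of the lateral slab at a general axis.**  For every unit `ν`, centre `c` and `a ≥ 0`, the
unit-height slab `{y : lateralSq ν c y ≤ a², |⟪y, ν⟫| ≤ 1/2}` of the cylinder of radius `a` about the axis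
`c + ℝ ν` has volume `π a²`. -/
theorem volume_lateralSlab (ν : EuclideanSpace ℝ (Fin 3)) (hν : ‖ν‖ = 1) (c : EuclideanSpace ℝ (Fin 3))
    (a : ℝ) (ha : 0 ≤ a) :
    volume {y : EuclideanSpace ℝ (Fin 3) | lateralSq ν c y ≤ a ^ 2 ∧ |⟪y, ν⟫_ℝ| ≤ 1 / 2} =
      ENNReal.ofReal a ^ 2 * ENNReal.ofReal Real.pi := by
  obtain ⟨g, hg⟩ := exists_linearIsometryEquiv_apply_eq_single_two ν hν
  rw [lateralSlab_eq_preimage ν hν c a, measure_preimage_add_right,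
    lateralSlab_origin_eq_preimage ν g hg a,
    g.measurePreserving.measure_preimage (measurableSet_cylinder_fin_three a).nullMeasurableSet,
    volume_cylinder_fin_three a ha]

/-- The lateral slab has volume `π a²` as a real number. -/
theorem volume_lateralSlab_toReal (ν : EuclideanSpace ℝ (Fin 3)) (hν : ‖ν‖ = 1)
    (c : EuclideanSpace ℝ (Fin 3)) (a : ℝ) (ha : 0 ≤ a) :
    (volume {y : EuclideanSpace ℝ (Fin 3) | lateralSq ν c y ≤ a ^ 2 ∧ |⟪y, ν⟫_ℝ| ≤ 1 / 2}).toReal =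
      Real.pi * a ^ 2 := by
  rw [volume_lateralSlab ν hν c a ha, ENNReal.toReal_mul, ENNReal.toReal_pow,
    ENNReal.toReal_ofReal ha, ENNReal.toReal_ofReal Real.pi_pos.le]
  ring

/-! ### The cell flux of any ball is at most `2 π a²` -/

/-- Each free slab lies in the lateral slab of its ball, so `τᵢ(ν) ≤ 2 π a²` for every ball of every
configuration (`a ≥ 0`, any `κ`). -/
theorem cellFlux_le_two_pi_mul_sq (ν : EuclideanSpace ℝ (Fin 3)) (hν : ‖ν‖ = 1) (a κ : ℝ) (ha : 0 ≤ a)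
    {N : ℕ} (x : Fin N → EuclideanSpace ℝ (Fin 3)) (i : Fin N) :
    cellFlux ν a κ x i ≤ 2 * Real.pi * a ^ 2 := by
  have hsubU : upperFreeSlab ν a κ x i ⊆
      {y : EuclideanSpace ℝ (Fin 3) | lateralSq ν (x i) y ≤ a ^ 2 ∧ |⟪y, ν⟫_ℝ| ≤ 1 / 2} :=
    fun y hy => ⟨hy.1, hy.2.1⟩
  have hsubL : lowerFreeSlab ν a κ x i ⊆
      {y : EuclideanSpace ℝ (Fin 3) | lateralSq ν (x i) y ≤ a ^ 2 ∧ |⟪y, ν⟫_ℝ| ≤ 1 / 2} :=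
    fun y hy => ⟨hy.1, hy.2.1⟩
  have hfin : volume {y : EuclideanSpace ℝ (Fin 3) | lateralSq ν (x i) y ≤ a ^ 2 ∧ |⟪y, ν⟫_ℝ| ≤ 1 / 2}
      ≠ ⊤ := by
    rw [volume_lateralSlab ν hν (x i) a ha]
    exact ENNReal.mul_ne_top (ENNReal.pow_ne_top ENNReal.ofReal_ne_top) ENNReal.ofReal_ne_top
  have hU := ENNReal.toReal_mono hfin (measure_mono hsubU)
  have hL := ENNReal.toReal_mono hfin (measure_mono hsubL)
  rw [volume_lateralSlab_toReal ν hν (x i) a ha] at hU hL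
  unfold cellFlux
  linarith

/-- `fluxRadius² = √3 / π`. -/
theorem fluxRadius_sq : fluxRadius ^ 2 = Real.sqrt 3 / Real.pi := by
  unfold fluxRadius
  exact Real.sq_sqrt (div_nonneg (Real.sqrt_nonneg 3) Real.pi_pos.le)

/-- `fluxRadius ≥ 0`. -/
theorem fluxRadius_nonneg : 0 ≤ fluxRadius := by
  unfold fluxRadius; exact Real.sqrt_nonneg _

/-- The calibration identity: `2√3 · (2 π · fluxRadius²) = 12`. -/
theorem two_sqrt_three_mul_two_pi_mul_fluxRadius_sq :
    2 * Real.sqrt 3 * (2 * Real.pi * fluxRadius ^ 2) = 12 := by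
  rw [fluxRadius_sq]
  have h3 : Real.sqrt 3 * Real.sqrt 3 = 3 := Real.mul_self_sqrt (by norm_num)
  field_simp
  nlinarith [h3]

/-! ### The `d = 0` instance, by name, and its sharpness -/

/-- **`LocalFluxBoundAt a κ 0` for every `a ∈ [0, fluxRadius]` and every `κ`** (planner cf-p1 g15's `d = 0`
instance of the term-wise local flux bound, CellFlux.lean; a hypothesis of `BlanketOfPoolFlux`,
`BlanketOfStarFlux`, `BlanketOfRimPool`): a ball with no contact satisfies `2√3 · τᵢ(ν) ≤ 12`, because
`τᵢ ≤ 2 π a² ≤ 2 π · fluxRadius² = 2√3 / 1 · … = 12 / (2√3)`.  The coordination hypothesis is not even used: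
the bound `2√3 τᵢ ≤ 12` holds for every ball. -/
theorem localFluxBoundAt_zero : ∀ a κ : ℝ, 0 ≤ a →
    a ≤ Summit.Ventures.Crystal3D.Cruxes.NoReconstructionGain.CellFlux.fluxRadius →
      Summit.Ventures.Crystal3D.Cruxes.NoReconstructionGain.CellFlux.LocalFluxBoundAt a κ 0 := by
  intro a κ h0 ha N x _hx ν hν i _hi
  have h1 := cellFlux_le_two_pi_mul_sq ν hν a κ h0 x i
  have h2 : a ^ 2 ≤ fluxRadius ^ 2 := pow_le_pow_left₀ h0 ha 2
  have h3 : 0 ≤ Real.sqrt 3 := Real.sqrt_nonneg 3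
  have h4 := two_sqrt_three_mul_two_pi_mul_fluxRadius_sq
  push_cast
  nlinarith [mul_le_mul_of_nonneg_left h1 (by positivity : (0 : ℝ) ≤ 2 * Real.sqrt 3),
    mul_le_mul_of_nonneg_left h2 (by positivity : (0 : ℝ) ≤ 2 * Real.sqrt 3 * (2 * Real.pi))]

/-- For a one-ball configuration the upper free slab IS the lateral slab (there is no other body). -/
theorem upperFreeSlab_fin_one (ν : EuclideanSpace ℝ (Fin 3)) (a κ : ℝ)
    (x : Fin 1 → EuclideanSpace ℝ (Fin 3)) :
    upperFreeSlab ν a κ x 0 =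
      {y : EuclideanSpace ℝ (Fin 3) | lateralSq ν (x 0) y ≤ a ^ 2 ∧ |⟪y, ν⟫_ℝ| ≤ 1 / 2} := by
  ext y
  simp only [upperFreeSlab, Set.mem_setOf_eq]
  constructor
  · rintro ⟨h1, h2, -⟩; exact ⟨h1, h2⟩
  · rintro ⟨h1, h2⟩; exact ⟨h1, h2, fun j hj => absurd (Subsingleton.elim j 0) hj⟩

/-- For a one-ball configuration the lower free slab IS the lateral slab. -/
theorem lowerFreeSlab_fin_one (ν : EuclideanSpace ℝ (Fin 3)) (a κ : ℝ)
    (x : Fin 1 → EuclideanSpace ℝ (Fin 3)) :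
    lowerFreeSlab ν a κ x 0 =
      {y : EuclideanSpace ℝ (Fin 3) | lateralSq ν (x 0) y ≤ a ^ 2 ∧ |⟪y, ν⟫_ℝ| ≤ 1 / 2} := by
  ext y
  simp only [lowerFreeSlab, Set.mem_setOf_eq]
  constructor
  · rintro ⟨h1, h2, -⟩; exact ⟨h1, h2⟩
  · rintro ⟨h1, h2⟩; exact ⟨h1, h2, fun j hj => absurd (Subsingleton.elim j 0) hj⟩

/-- An isolated ball has cell flux exactly `2 π a²` (`a ≥ 0`, any `κ`, any unit `ν`). -/
theorem cellFlux_fin_one (ν : EuclideanSpace ℝ (Fin 3)) (hν : ‖ν‖ = 1) (a κ : ℝ) (ha : 0 ≤ a)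
    (x : Fin 1 → EuclideanSpace ℝ (Fin 3)) :
    cellFlux ν a κ x 0 = 2 * Real.pi * a ^ 2 := by
  unfold cellFlux
  rw [upperFreeSlab_fin_one, lowerFreeSlab_fin_one, volume_lateralSlab_toReal ν hν (x 0) a ha]
  ring

/-- **Sharpness**: for `a > fluxRadius` the `d = 0` instance FAILS — an isolated ball has
`2√3 · τ = 2√3 · 2 π a² > 12`. -/
theorem not_localFluxBoundAt_zero_of_lt (a κ : ℝ) (ha : fluxRadius < a) : ¬ LocalFluxBoundAt a κ 0 := by
  intro h
  have ha0 : 0 ≤ a := fluxRadius_nonneg.trans ha.le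
  set x : Fin 1 → EuclideanSpace ℝ (Fin 3) := fun _ => 0 with hx
  have hpack : IsUnitPacking x := isUnitPacking_of_subsingleton x
  have hν : ‖EuclideanSpace.single (2 : Fin 3) (1 : ℝ)‖ = 1 := norm_e3
  have hcoord : coordination x 0 = 0 := by
    unfold coordination
    rw [Finset.card_eq_zero, Finset.eq_empty_iff_forall_notMem]
    intro j hj
    exact ((mem_contactNeighbors x).1 hj).1 (Subsingleton.elim j 0)
  have h1 := h 1 x hpack _ hν 0 hcoord
  rw [cellFlux_fin_one _ hν a κ ha0 x] at h1
  have h2 : fluxRadius ^ 2 < a ^ 2 := pow_lt_pow_left₀ ha fluxRadius_nonneg two_ne_zero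
  have h3 : 0 < Real.sqrt 3 := Real.sqrt_pos.2 (by norm_num)
  have h4 := two_sqrt_three_mul_two_pi_mul_fluxRadius_sq
  push_cast at h1
  nlinarith [mul_lt_mul_of_pos_left h2 (by positivity : (0 : ℝ) < 2 * Real.sqrt 3 * (2 * Real.pi))]

/-- **The `d = 0` instance is exactly the calibration `a ≤ fluxRadius`** (any `κ`, `a ≥ 0`). -/
theorem localFluxBoundAt_zero_iff (a κ : ℝ) (h0 : 0 ≤ a) : LocalFluxBoundAt a κ 0 ↔ a ≤ fluxRadius :=
  ⟨fun h => not_lt.1 fun hlt => not_localFluxBoundAt_zero_of_lt a κ hlt h,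
    fun h => localFluxBoundAt_zero a κ h0 h⟩

end Summit.Ventures.Crystal3D.Theorems

end
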